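import Mathlib
import Literature.Analysis.SpecialFunctions.DigammaVerticalSeries
import HarnessLib

/-!
# A logarithmic minorant of the archimedean weight `Re ψ(1/4 + it/2)`

Stub `stub_reDigammaQuarter_ge` for the line *parity–multiplicity–commutator* of the crux
`GroundStateSimpleEven` (Weil ground state): the explicit monotone minorant

  `Re ψ(1/4) + 16t²/(1+4t²) + 4t²/(5(25/4+t²)) + 2t²/(9(81/4+t²)) + (1/2) log(1 + 4t²/81)
     ≤ Re ψ(1/4 + it/2)`.

Proof (Euler–Maclaurin / trapezoid rule for a convex summand). By the vertical series
`Re ψ(1/4 + it/2) − Re ψ(1/4) = Σ_{m ≥ 0} f_{l_m}(t)`, `f_l(t) = 2t²/(l(l² + t²))`,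
`l_m = 2m + 1/2` (`Literature.Analysis.SpecialFunctions.hasSum_digammaTerm`), it suffices to
bound the tail `Σ_{m ≥ 2} f_{l_m}(t)` from below by `f_{l_2}(t)/2 + (1/2) log(1 + 4t²/81)`.
The function `l ↦ f_l(t)` is convex on `(0, ∞)`, with primitive `F(l) = 2 log l − log(l² + t²)`,
so the trapezoid rule overestimates its integral: `F(a+2) − F(a) ≤ f_a(t) + f_{a+2}(t)` for
`a > 0` (proved by one differentiation: `l ↦ F(l) − (l − a)(f_a(t) + f_l(t))/2` has the
non-positive derivative `(f_l(t) − f_a(t) − (l − a) ∂_l f_l(t))/2`, an explicit negative multiple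
of `(l − a)²`). Summing over `a = l_2, …, l_{K+1}` and letting `K → ∞`
(`F(l_2) = −log(1 + 4t²/81)`, `F(l) ≥ −t²/l² → 0`) gives the claim.
-/

open Set Filter
open scoped Real Topology
open Literature.Analysis.SpecialFunctions

namespace Summit.RiemannHypothesis.RiemannHypothesis.Theorems

namespace GroundStateSimpleEven

set_option linter.dupNamespace false in
/-- `d/dl (2 log l − log(l² + t²)) = 2t²/(l(l² + t²)) = f_l(t)` for `l > 0`. [folklore] -/
lemma psi_hasDerivAt_prim (t : ℝ) {l : ℝ} (hl : 0 < l) :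
    HasDerivAt (fun l : ℝ ↦ 2 * Real.log l - Real.log (l ^ 2 + t ^ 2))
      (2 * t ^ 2 / (l * (l ^ 2 + t ^ 2))) l := by
  have h0 : 0 < l ^ 2 + t ^ 2 := by positivity
  have h1 : HasDerivAt (fun l : ℝ ↦ 2 * Real.log l) (2 * l⁻¹) l :=
    (Real.hasDerivAt_log hl.ne').const_mul 2
  have h2 : HasDerivAt (fun l : ℝ ↦ l ^ 2 + t ^ 2) (2 * l) l := by
    simpa using (hasDerivAt_pow 2 l).add_const (t ^ 2)
  have h3 : HasDerivAt (fun l : ℝ ↦ Real.log (l ^ 2 + t ^ 2)) (2 * l / (l ^ 2 + t ^ 2)) l :=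
    h2.log h0.ne'
  refine (h1.sub h3).congr_deriv ?_
  field_simp
  ring

set_option linter.dupNamespace false in
/-- `∂_l f_l(t) = −2t²(3l² + t²)/(l²(l² + t²)²)` for `l > 0`. [folklore] -/
lemma psi_hasDerivAt_term (t : ℝ) {l : ℝ} (hl : 0 < l) :
    HasDerivAt (fun l : ℝ ↦ 2 * t ^ 2 / (l * (l ^ 2 + t ^ 2)))
      (-(2 * t ^ 2 * (3 * l ^ 2 + t ^ 2)) / (l ^ 2 * (l ^ 2 + t ^ 2) ^ 2)) l := by
  have h0 : 0 < l ^ 2 + t ^ 2 := by positivity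
  have h2 : HasDerivAt (fun l : ℝ ↦ l ^ 2 + t ^ 2) (2 * l) l := by
    simpa using (hasDerivAt_pow 2 l).add_const (t ^ 2)
  have hd : HasDerivAt (fun l : ℝ ↦ l * (l ^ 2 + t ^ 2)) (1 * (l ^ 2 + t ^ 2) + l * (2 * l)) l :=
    (hasDerivAt_id' l).mul h2
  have h := (hasDerivAt_const l (2 * t ^ 2)).div hd (by positivity)
  refine h.congr_deriv ?_
  field_simp
  ring

set_option linter.dupNamespace false in
/-- The tangent-line (convexity) inequality for `l ↦ f_l(t)` in factored form:
`(f_l − f_a − (l − a) ∂_l f_l)/2 = −t²(l − a)²(l²(l² + 2al + 3a²) + t²(2l² + a²) + t⁴) /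
(a(a² + t²) l² (l² + t²)²) ≤ 0`. [folklore] -/
lemma psi_tangent_nonpos (t : ℝ) {a l : ℝ} (ha : 0 < a) (hl : 0 < l) :
    2 * t ^ 2 / (l * (l ^ 2 + t ^ 2)) -
        (1 * (2 * t ^ 2 / (a * (a ^ 2 + t ^ 2)) + 2 * t ^ 2 / (l * (l ^ 2 + t ^ 2))) +
          (l - a) * (-(2 * t ^ 2 * (3 * l ^ 2 + t ^ 2)) / (l ^ 2 * (l ^ 2 + t ^ 2) ^ 2))) / 2
      ≤ 0 := by
  have h1 : 0 < l ^ 2 + t ^ 2 := by positivity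
  have h2 : 0 < a ^ 2 + t ^ 2 := by positivity
  have key : 2 * t ^ 2 / (l * (l ^ 2 + t ^ 2)) -
        (1 * (2 * t ^ 2 / (a * (a ^ 2 + t ^ 2)) + 2 * t ^ 2 / (l * (l ^ 2 + t ^ 2))) +
          (l - a) * (-(2 * t ^ 2 * (3 * l ^ 2 + t ^ 2)) / (l ^ 2 * (l ^ 2 + t ^ 2) ^ 2))) / 2 =
      -(t ^ 2 * (l - a) ^ 2 *
          (l ^ 2 * (l ^ 2 + 2 * a * l + 3 * a ^ 2) + t ^ 2 * (2 * l ^ 2 + a ^ 2) + t ^ 4) /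
        (a * (a ^ 2 + t ^ 2) * l ^ 2 * (l ^ 2 + t ^ 2) ^ 2)) := by
    field_simp
    ring
  rw [key, neg_nonpos]
  positivity

set_option linter.dupNamespace false in
/-- **Trapezoid rule for the convex function `l ↦ f_l(t)` on `[a, a + 2]`, `a > 0`:**
`F(a+2) − F(a) ≤ f_a(t) + f_{a+2}(t)` with the primitive `F(l) = 2 log l − log(l² + t²)`
(the auxiliary function `l ↦ F(l) − (l − a)(f_a(t) + f_l(t))/2` is decreasing on `[a, ∞)`).
[folklore] -/
lemma psi_trapezoid (t : ℝ) {a : ℝ} (ha : 0 < a) :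
    (2 * Real.log (a + 2) - Real.log ((a + 2) ^ 2 + t ^ 2)) -
        (2 * Real.log a - Real.log (a ^ 2 + t ^ 2)) ≤
      2 * t ^ 2 / (a * (a ^ 2 + t ^ 2)) + 2 * t ^ 2 / ((a + 2) * ((a + 2) ^ 2 + t ^ 2)) := by
  have hderiv : ∀ l : ℝ, 0 < l → HasDerivAt
      (fun l : ℝ ↦ 2 * Real.log l - Real.log (l ^ 2 + t ^ 2) -
        (l - a) * (2 * t ^ 2 / (a * (a ^ 2 + t ^ 2)) + 2 * t ^ 2 / (l * (l ^ 2 + t ^ 2))) / 2)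
      (2 * t ^ 2 / (l * (l ^ 2 + t ^ 2)) -
        (1 * (2 * t ^ 2 / (a * (a ^ 2 + t ^ 2)) + 2 * t ^ 2 / (l * (l ^ 2 + t ^ 2))) +
          (l - a) * (-(2 * t ^ 2 * (3 * l ^ 2 + t ^ 2)) / (l ^ 2 * (l ^ 2 + t ^ 2) ^ 2))) / 2)
      l := by
    intro l hl
    have hlin : HasDerivAt (fun l : ℝ ↦ l - a) 1 l := (hasDerivAt_id' l).sub_const a
    exact (psi_hasDerivAt_prim t hl).sub
      ((hlin.mul ((psi_hasDerivAt_term t hl).const_add _)).div_const 2)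
  have hanti : AntitoneOn
      (fun l : ℝ ↦ 2 * Real.log l - Real.log (l ^ 2 + t ^ 2) -
        (l - a) * (2 * t ^ 2 / (a * (a ^ 2 + t ^ 2)) + 2 * t ^ 2 / (l * (l ^ 2 + t ^ 2))) / 2)
      (Ici a) := by
    refine antitoneOn_of_hasDerivWithinAt_nonpos (convex_Ici a)
      (f' := fun l : ℝ ↦ 2 * t ^ 2 / (l * (l ^ 2 + t ^ 2)) -
        (1 * (2 * t ^ 2 / (a * (a ^ 2 + t ^ 2)) + 2 * t ^ 2 / (l * (l ^ 2 + t ^ 2))) +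
          (l - a) * (-(2 * t ^ 2 * (3 * l ^ 2 + t ^ 2)) / (l ^ 2 * (l ^ 2 + t ^ 2) ^ 2))) / 2)
      ?_ ?_ ?_
    · exact fun l hl ↦ (hderiv l (ha.trans_le (mem_Ici.1 hl))).continuousAt.continuousWithinAt
    · rw [interior_Ici]
      exact fun l hl ↦ (hderiv l (ha.trans (mem_Ioi.1 hl))).hasDerivWithinAt
    · rw [interior_Ici]
      exact fun l hl ↦ psi_tangent_nonpos t ha (ha.trans (mem_Ioi.1 hl))
  have h := hanti (mem_Ici.2 le_rfl) (mem_Ici.2 (by linarith : a ≤ a + 2))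
    (by linarith : a ≤ a + 2)
  simp only [add_sub_cancel_left, sub_self, zero_mul, zero_div, sub_zero] at h
  linarith

set_option linter.dupNamespace false in
/-- `l_{m+1} = l_m + 2`. [folklore] -/
lemma psi_digammaNode_succ (m : ℕ) : digammaNode (m + 1) = digammaNode m + 2 := by
  unfold digammaNode; push_cast; ring

set_option linter.dupNamespace false in
/-- Summed trapezoid bound: with `F(l) = 2 log l − log(l² + t²)`,
`F(l_{K+2}) − F(l_2) ≤ 2 Σ_{j ≤ K} f_{l_{j+2}}(t) − f_{l_2}(t)`. [folklore] -/
lemma psi_sum_trapezoid (t : ℝ) (K : ℕ) :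
    (2 * Real.log (digammaNode (K + 2)) - Real.log (digammaNode (K + 2) ^ 2 + t ^ 2)) -
        (2 * Real.log (digammaNode 2) - Real.log (digammaNode 2 ^ 2 + t ^ 2)) ≤
      2 * ∑ j ∈ Finset.range (K + 1), digammaTerm (digammaNode (j + 2)) t -
        digammaTerm (digammaNode 2) t := by
  set F : ℕ → ℝ := fun j ↦ 2 * Real.log (digammaNode (j + 2)) -
    Real.log (digammaNode (j + 2) ^ 2 + t ^ 2)
  set f : ℕ → ℝ := fun j ↦ digammaTerm (digammaNode (j + 2)) t
  have hstep : ∀ j, F (j + 1) - F j ≤ f j + f (j + 1) := by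
    intro j
    have h := psi_trapezoid t (digammaNode_pos (j + 2))
    have e : digammaNode (j + 2) + 2 = digammaNode (j + 1 + 2) := by
      unfold digammaNode; push_cast; ring
    rw [e] at h
    exact h
  have htel : ∑ j ∈ Finset.range K, (F (j + 1) - F j) = F K - F 0 := Finset.sum_range_sub F K
  have hle : ∑ j ∈ Finset.range K, (F (j + 1) - F j) ≤
      ∑ j ∈ Finset.range K, (f j + f (j + 1)) := Finset.sum_le_sum fun j _ ↦ hstep j
  rw [Finset.sum_add_distrib] at hle
  have h1 : ∑ j ∈ Finset.range (K + 1), f j = ∑ j ∈ Finset.range K, f j + f K :=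
    Finset.sum_range_succ f K
  have h2 : ∑ j ∈ Finset.range (K + 1), f j = ∑ j ∈ Finset.range K, f (j + 1) + f 0 :=
    Finset.sum_range_succ' f K
  have hK : 0 ≤ f K := digammaTerm_nonneg (digammaNode_pos _) t
  show F K - F 0 ≤ 2 * ∑ j ∈ Finset.range (K + 1), f j - f 0
  linarith

set_option linter.dupNamespace false in
/-- `F(l_2) = 2 log(9/2) − log(81/4 + t²) = −log(1 + 4t²/81)`. [folklore] -/
lemma psi_prim_two (t : ℝ) :
    2 * Real.log (digammaNode 2) - Real.log (digammaNode 2 ^ 2 + t ^ 2) =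
      -Real.log (1 + 4 * t ^ 2 / 81) := by
  have e : digammaNode 2 = 9 / 2 := by unfold digammaNode; norm_num
  rw [e]
  have h1 : ((9 : ℝ) / 2) ^ 2 + t ^ 2 = (9 / 2) ^ 2 * (1 + 4 * t ^ 2 / 81) := by ring
  have h2 : (0 : ℝ) < 1 + 4 * t ^ 2 / 81 := by positivity
  rw [h1, Real.log_mul (by positivity) h2.ne', Real.log_pow]
  push_cast
  ring

set_option linter.dupNamespace false in
/-- `−t²/l² ≤ F(l) = −log(1 + t²/l²)` for `l > 0`. [folklore] -/
lemma psi_prim_ge (t : ℝ) {l : ℝ} (hl : 0 < l) :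
    -(t ^ 2 / l ^ 2) ≤ 2 * Real.log l - Real.log (l ^ 2 + t ^ 2) := by
  have h1 : l ^ 2 + t ^ 2 = l ^ 2 * (1 + t ^ 2 / l ^ 2) := by
    field_simp
  have h2 : (0 : ℝ) < 1 + t ^ 2 / l ^ 2 := by positivity
  rw [h1, Real.log_mul (by positivity) h2.ne', Real.log_pow]
  have := Real.log_le_sub_one_of_pos h2
  push_cast
  linarith

set_option linter.dupNamespace false in
/-- **Tail bound.** `f_{l_2}(t)/2 + (1/2) log(1 + 4t²/81) ≤ Σ_{m ≥ 2} f_{l_m}(t)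
 = Re ψ(1/4 + it/2) − Re ψ(1/4) − f_{l_0}(t) − f_{l_1}(t)`. [folklore] -/
lemma psi_tail_ge (t : ℝ) :
    digammaTerm (digammaNode 2) t / 2 + Real.log (1 + 4 * t ^ 2 / 81) / 2 ≤
      reDigammaQuarter t - reDigammaQuarter 0 -
        ∑ i ∈ Finset.range 2, digammaTerm (digammaNode i) t := by
  have hS := (hasSum_nat_add_iff' 2).2 (hasSum_digammaTerm t)
  set S := reDigammaQuarter t - reDigammaQuarter 0 -
    ∑ i ∈ Finset.range 2, digammaTerm (digammaNode i) t
  set C := digammaTerm (digammaNode 2) t / 2 + Real.log (1 + 4 * t ^ 2 / 81) / 2 with hC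
  have hpart : ∀ K : ℕ, C - t ^ 2 / digammaNode (K + 2) ^ 2 / 2 ≤ S := by
    intro K
    have h1 : ∑ j ∈ Finset.range (K + 1), digammaTerm (digammaNode (j + 2)) t ≤ S :=
      sum_le_hasSum (Finset.range (K + 1)) (fun j _ ↦ digammaTerm_nonneg (digammaNode_pos _) t)
        hS
    have h2 := psi_sum_trapezoid t K
    rw [psi_prim_two] at h2
    have h3 := psi_prim_ge t (digammaNode_pos (K + 2))
    linarith
  have hlim0 : Tendsto (fun K : ℕ ↦ t ^ 2 / digammaNode (K + 2) ^ 2) atTop (𝓝 0) := by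
    refine squeeze_zero (g := fun K : ℕ ↦ 2 * t ^ 2 * (1 / ((K : ℝ) + 1)))
      (fun K ↦ by positivity) (fun K ↦ ?_) ?_
    · have hnode := digammaNode_pos (K + 2)
      have hden : (K : ℝ) + 1 ≤ 2 * digammaNode (K + 2) ^ 2 := by
        unfold digammaNode; push_cast; nlinarith
      have hpos : (0 : ℝ) < (K : ℝ) + 1 := by positivity
      show t ^ 2 / digammaNode (K + 2) ^ 2 ≤ 2 * t ^ 2 * (1 / ((K : ℝ) + 1))
      rw [mul_one_div, div_le_div_iff₀ (by positivity) hpos]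
      nlinarith [mul_le_mul_of_nonneg_left hden (sq_nonneg t)]
    · simpa only [mul_zero] using
        (tendsto_one_div_add_atTop_nhds_zero_nat (𝕜 := ℝ)).const_mul (2 * t ^ 2)
  have hlim : Tendsto (fun K : ℕ ↦ C - t ^ 2 / digammaNode (K + 2) ^ 2 / 2) atTop
      (𝓝 (C - 0 / 2)) := (hlim0.div_const 2).const_sub C
  have h := le_of_tendsto' hlim hpart
  simpa using h

end GroundStateSimpleEven

set_option linter.dupNamespace false in
/-- **Logarithmic minorant of the archimedean weight** (Euler–Maclaurin for the vertical series):
for every real `t`,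
`Re ψ(1/4) + 16t²/(1+4t²) + 4t²/(5(25/4+t²)) + 2t²/(9(81/4+t²)) + (1/2) log(1 + 4t²/81)
 ≤ Re ψ(1/4 + it/2)`; the three rational terms are `f_{l_0}(t)`, `f_{l_1}(t)`, `f_{l_2}(t)/2` and
`(1/2) log(1 + 4t²/81) = ∫_2^∞ f_{2x+1/2}(t) dx`. [folklore] -/
theorem stub_reDigammaQuarter_ge :
    ∀ t : ℝ, Literature.Analysis.SpecialFunctions.reDigammaQuarter 0 +
        16 * t ^ 2 / (1 + 4 * t ^ 2) + 4 * t ^ 2 / (5 * (25 / 4 + t ^ 2)) +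
        2 * t ^ 2 / (9 * (81 / 4 + t ^ 2)) + Real.log (1 + 4 * t ^ 2 / 81) / 2 ≤
      Literature.Analysis.SpecialFunctions.reDigammaQuarter t := by
  intro t
  have htail := GroundStateSimpleEven.psi_tail_ge t
  have h0 : digammaTerm (digammaNode 0) t = 16 * t ^ 2 / (1 + 4 * t ^ 2) := by
    have : (0 : ℝ) < 1 + 4 * t ^ 2 := by positivity
    unfold digammaTerm digammaNode
    push_cast
    field_simp
    ring
  have h1 : digammaTerm (digammaNode 1) t = 4 * t ^ 2 / (5 * (25 / 4 + t ^ 2)) := by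
    have : (0 : ℝ) < 25 / 4 + t ^ 2 := by positivity
    unfold digammaTerm digammaNode
    push_cast
    field_simp
    ring
  have h2 : digammaTerm (digammaNode 2) t / 2 = 2 * t ^ 2 / (9 * (81 / 4 + t ^ 2)) := by
    have : (0 : ℝ) < 81 / 4 + t ^ 2 := by positivity
    unfold digammaTerm digammaNode
    push_cast
    field_simp
    ring
  rw [Finset.sum_range_succ, Finset.sum_range_one, h0, h1, h2] at htail
  linarith

end Summit.RiemannHypothesis.RiemannHypothesis.Theorems
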